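/- Copyright: cell `pub-balaban-gaps` (YM BLITZ Y1, track G2), seat ne6 = row NE7b, gen 6 — (A1c)-facing GENERIC supplier, file 3
(the 𝐑 half): [B15] (0.3)'s NORMALISED TERM as a finite transition kernel of one level, in the `lmarginal` model of
`Lit.….B15.BasicStep`.  Released under the licence of the surrounding project. -/
import Mathlib.Probability.Kernel.Composition.MeasureComp
import Literature.MathematicalPhysics.QuantumFieldTheory.Balaban1983to89.B15BasicStep

/-!
# `T4Continuum.Spine.NE7b.StepKernelNormTerm` — row NE7b, (α)-instance, (A1c)-facing and GENERIC, file 3: the NORMALISED TERM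
# `f ↦ den · (∫⌈_s χ·f) ∕ (∫⌈_s den)` of [B15] (0.3) p. 176 ∕ (1.100) p. 201 IS a transition kernel `κ` of the level
# (`normTermKernel`), and `Lit.….B15.BasicStep.lmarginal_norm_term` — (0.4) ∕ (1.102) «for every density of the class» — IS the ONE
# measure identity `κ ∘ₘ (Π dμ) = χ·(Π dμ)` that file 1 (`StepKernelOps.hstep_of_comp_eq`) turns into the END's per-(step, choice)
# integral identity; its fibre masses are `den·(∫⌈_s χ)∕(∫⌈_s den)` (the step's weight `T1`)
# (cell `pub-balaban-gaps`, seat ne6 gen 6; record `HOME/ne/NE7b.md` §6 (10))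

HONEST FRAMING.  Finite four-torus programme, rung (B)+1 only — NOT infinite volume, NOT a mass gap, NOT the Clay problem, NOT
summit progress, NOT a proof of NE7b (`Literature.….T4WeightBudget.RelWeightBound`, the cell's OWN estimate — NOT PRINTED in
[Bałaban 1983–89], NOT PROVED; INSTANCE 0∕1).  Nothing of Bałaban's is asserted, valued or discharged: [folklore] measure theory over
Mathlib's `lmarginal` ∕ `Measure.pi` ∕ `Measure.bind` and the tree's PROVED (0.3)∕(0.4) mechanism `B15.BasicStep.lmarginal_norm_term`
(its printed provisos — denominators `≠ 0`, `≠ ∞`, p. 176 «the densities are positive … domains … nonempty» — stay HYPOTHESES here, as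
there).  WHICH `den` (small-field normalising density `ρ(Z″,·)` of the history), `χ` (the term's characteristic function) and `s`
(the integrated variables `Z′`) are Bałaban's is (A1c) DATA behind NEEDS-COORDINATOR NC-NE7b-α — NOT touched.  Spine PROVED 0∕9.

WHAT ([folklore]; one level = the product `Π i, G i` of finitely many measurable spaces with σ-finite reference measures `μ i`,
`∫⌈_s` = Mathlib's `lmarginal μ s`).
§1 `fibreLaw μ s w V` = the law of «`V` with its `s`-coordinates resampled from `Π_{i∈s} μ i`», weighted by `w`;
   `lintegral_fibreLaw : ∫⁻ g d(fibreLaw μ s w V) = (∫⌈_s w·g)(V)`; `fibreLaw_apply`; `measurable_fibreLaw` (a measurable family).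
§2 **`normTermKernel μ s den χ : Kernel (Π i, G i) (Π i, G i)`**, `V ↦ (den V · ((∫⌈_s den) V)⁻¹) • fibreLaw μ s χ V` — the operator
   `f ↦ den·(∫⌈_s χ·f)∕(∫⌈_s den)` read as a kernel (`lintegral_normTermKernel`); **`normTermKernel_comp_pi`: under the printed
   provisos `(∫⌈_s den) V ≠ 0, ≠ ∞` the ONE measure identity `normTermKernel μ s den χ ∘ₘ Measure.pi μ = (Measure.pi μ).withDensity χ`**
   (= `lmarginal_norm_term` + `lintegral_eq_of_lmarginal_eq`) — file 1's `hκ` for the 𝐑 ∘ χ half of a one-step operation;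
   `normTermKernel_univ` (the fibre mass = `den V·(∫⌈_s χ) V∕(∫⌈_s den) V` — the weight `T1 V`); `normTermKernel_isFinite` (a finite
   kernel as soon as `den ≤ c·∫⌈_s den` pointwise, `χ ≤ 1` and the `μ i` are probability measures — `c = e^{osc}` for a small-field
   Gibbs factor; the uniform ratio bound is a HYPOTHESIS).
NET for an (A1c) instance (with files 1–2): `op j g p := StepKernelOps.ofKernel (normTermKernel … ∘ₖ twist (fibreKernel avg ν_j) m_j)`,
its `hκ` = `normTermKernel_comp_pi` after `fibreKernel_twist_comp` (`Measure.comp_assoc`), `hstep := hstep_of_kernels`.  HONEST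
LIMITS: vacuous alone; BY-NAME EFFECT ON THE WALL (`WALL-NE7b-P1.md` §2): NONE; NE7b NOT proved; count 0∕9.  HONEST DEPENDENCY (cell):
continuum YM on T⁴ ⇐ BetaPertH ∧ nine spine estimates (0∕9 proved); BetaPertH ⇐ (D1) ∧ (D4) ∧ CAP+tail; G-an2-4 gates asym, D1 and
NE2∕3∕4.  This file changes none of it.
-/

open MeasureTheory ProbabilityTheory Function
open scoped ENNReal
open Literature.MathematicalPhysics.QuantumFieldTheory.Balaban1983to89

namespace Summit.QuantumFields.BalabanUV.T4Continuum.Spine.NE7b.StepKernelNormTerm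

noncomputable section

variable {ι : Type} [DecidableEq ι] {G : ι → Type} [∀ i, MeasurableSpace (G i)] (μ : ∀ i, Measure (G i)) (s : Finset ι)

/-! ## §1 The weighted fibre law: resampling the `s`-coordinates -/

/-- The law of «`V` with its `s`-coordinates resampled from `Π_{i∈s} μ i`», weighted by `w` (values in `ℝ≥0∞`). [folklore] -/
def fibreLaw (w : (∀ i, G i) → ℝ≥0∞) (V : ∀ i, G i) : Measure (∀ i, G i) :=
  ((Measure.pi fun i : s => μ i).withDensity fun y => w (updateFinset V s y)).map (updateFinset V s)

variable {μ s}

/-- Integrating against the weighted fibre law IS the marginal integral `∫⌈_s w·g`. [folklore] -/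
theorem lintegral_fibreLaw {w g : (∀ i, G i) → ℝ≥0∞} (hw : Measurable w) (hg : Measurable g) (V : ∀ i, G i) :
    ∫⁻ x, g x ∂fibreLaw μ s w V = (∫⋯∫⁻_s, w * g ∂μ) V := by
  rw [fibreLaw, lintegral_map hg measurable_updateFinset]
  exact lintegral_withDensity_eq_lintegral_mul _ (hw.comp measurable_updateFinset) (hg.comp measurable_updateFinset)

/-- The weighted fibre law of a measurable set. [folklore] -/
theorem fibreLaw_apply {w : (∀ i, G i) → ℝ≥0∞} (hw : Measurable w) {A : Set (∀ i, G i)} (hA : MeasurableSet A) (V : ∀ i, G i) :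
    fibreLaw μ s w V A = (∫⋯∫⁻_s, w * A.indicator 1 ∂μ) V := by
  rw [← lintegral_indicator_one hA, lintegral_fibreLaw hw (measurable_one.indicator hA)]

variable [∀ i, SigmaFinite (μ i)]

/-- The weighted fibre laws form a measurable family. [folklore] -/
theorem measurable_fibreLaw {w : (∀ i, G i) → ℝ≥0∞} (hw : Measurable w) : Measurable (fibreLaw μ s w) := by
  refine Measure.measurable_of_measurable_coe _ fun A hA => ?_
  simp_rw [fibreLaw_apply hw hA]
  exact (hw.mul (measurable_one.indicator hA)).lmarginal μ

/-! ## §2 The normalised term as a kernel, and its ONE measure identity -/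

variable (μ s) in
/-- **THE NORMALISED-TERM KERNEL** of [B15] (0.3) ∕ (1.100): `V ↦ (den V · ((∫⌈_s den) V)⁻¹) • fibreLaw μ s χ V` — so that
`∫ f dκ(V) = den V · (∫⌈_s χ·f)(V) ∕ (∫⌈_s den)(V)`, the `Z`-term of `(𝐑ρ)(V)` read as a LINEAR operator on `f` once the small-field
normalising density `den = ρ(Z″,·)` is the history's data. [folklore] -/
def normTermKernel (den χ : (∀ i, G i) → ℝ≥0∞) (hden : Measurable den) (hχ : Measurable χ) :
    Kernel (∀ i, G i) (∀ i, G i) where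
  toFun V := (den V * ((∫⋯∫⁻_s, den ∂μ) V)⁻¹) • fibreLaw μ s χ V
  measurable' := by
    refine Measure.measurable_of_measurable_coe _ fun A hA => ?_
    simp only [Measure.smul_apply, smul_eq_mul]
    exact (hden.mul (hden.lmarginal μ).inv).mul ((Measure.measurable_coe hA).comp (measurable_fibreLaw hχ))

variable {den χ : (∀ i, G i) → ℝ≥0∞} (hden : Measurable den) (hχ : Measurable χ)

/-- The kernel at `V` is the announced scalar multiple of the weighted fibre law. [folklore] -/
theorem normTermKernel_apply (V : ∀ i, G i) :
    normTermKernel μ s den χ hden hχ V = (den V * ((∫⋯∫⁻_s, den ∂μ) V)⁻¹) • fibreLaw μ s χ V := rfl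

/-- **THE KERNEL IS THE NORMALISED TERM**: `∫ g dκ(V) = den V · (∫⌈_s den)(V)⁻¹ · (∫⌈_s χ·g)(V)`. [folklore] -/
theorem lintegral_normTermKernel {g : (∀ i, G i) → ℝ≥0∞} (hg : Measurable g) (V : ∀ i, G i) :
    ∫⁻ x, g x ∂normTermKernel μ s den χ hden hχ V = den V * ((∫⋯∫⁻_s, den ∂μ) V)⁻¹ * (∫⋯∫⁻_s, χ * g ∂μ) V := by
  rw [normTermKernel_apply, lintegral_smul_measure, lintegral_fibreLaw hχ hg, smul_eq_mul]

/-- The fibre mass of the normalised-term kernel on a measurable set. [folklore] -/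
theorem normTermKernel_apply_set {A : Set (∀ i, G i)} (hA : MeasurableSet A) (V : ∀ i, G i) :
    normTermKernel μ s den χ hden hχ V A = den V * ((∫⋯∫⁻_s, den ∂μ) V)⁻¹ * (∫⋯∫⁻_s, χ * A.indicator 1 ∂μ) V := by
  rw [← lintegral_indicator_one hA, lintegral_normTermKernel hden hχ (measurable_one.indicator hA)]

/-- **THE WEIGHT**: the total fibre mass at `V` is `den V · (∫⌈_s χ)(V) ∕ (∫⌈_s den)(V)` — the quantity `T1 V` of the step. [folklore] -/
theorem normTermKernel_univ (V : ∀ i, G i) :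
    normTermKernel μ s den χ hden hχ V Set.univ = den V * ((∫⋯∫⁻_s, den ∂μ) V)⁻¹ * (∫⋯∫⁻_s, χ ∂μ) V := by
  rw [normTermKernel_apply_set hden hχ MeasurableSet.univ]
  simp

/-- **A FINITE KERNEL UNDER A UNIFORM RATIO BOUND**: if `den ≤ c·∫⌈_s den` pointwise with `c ≠ ∞` (for a small-field Gibbs factor
`c = e^{osc}` — a HYPOTHESIS here), `χ ≤ 1`, the `μ i` are probability measures and the denominators are neither `0` nor `∞`, then every
fibre mass is `≤ c`, so the normalised-term kernel is finite (and file 1's `ofKernel` applies). [folklore] -/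
theorem normTermKernel_isFinite [∀ i, IsProbabilityMeasure (μ i)] {c : ℝ≥0∞} (hc : c ≠ ∞)
    (hratio : ∀ V, den V ≤ c * (∫⋯∫⁻_s, den ∂μ) V) (hχ1 : ∀ V, χ V ≤ 1)
    (h0 : ∀ V, (∫⋯∫⁻_s, den ∂μ) V ≠ 0) (htop : ∀ V, (∫⋯∫⁻_s, den ∂μ) V ≠ ∞) :
    IsFiniteKernel (normTermKernel μ s den χ hden hχ) := by
  refine ⟨⟨c, hc.lt_top, fun V => ?_⟩⟩
  rw [normTermKernel_univ hden hχ]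
  have h1 : (∫⋯∫⁻_s, χ ∂μ) V ≤ 1 :=
    calc (∫⋯∫⁻_s, χ ∂μ) V ≤ (∫⋯∫⁻_s, (fun _ => 1) ∂μ) V := lmarginal_mono (fun x => hχ1 x) V
      _ = 1 := by simp [lmarginal]
  calc den V * ((∫⋯∫⁻_s, den ∂μ) V)⁻¹ * (∫⋯∫⁻_s, χ ∂μ) V
      ≤ c * (∫⋯∫⁻_s, den ∂μ) V * ((∫⋯∫⁻_s, den ∂μ) V)⁻¹ * 1 := mul_le_mul' (mul_le_mul' (hratio V) le_rfl) h1
    _ = c := by rw [mul_one, mul_assoc, ENNReal.mul_inv_cancel (h0 V) (htop V), mul_one]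

variable [Fintype ι]

/-- **(0.4) ∕ (1.102) AS ONE MEASURE IDENTITY.**  Under the printed provisos — every denominator `(∫⌈_s den)(V)` is neither `0` nor
`∞` ([B15] p. 176 «the densities are positive, and the integration domains … nonempty, hence the denominators are positive») — the
normalised-term kernel composed with the product reference measure IS the reference measure with density `χ`:
`κ ∘ₘ Π dμ = χ·Π dμ`.  Proof = the tree's `B15.BasicStep.lmarginal_norm_term` (fibrewise) + `lintegral_eq_of_lmarginal_eq`. [folklore] -/
theorem normTermKernel_comp_pi (h0 : ∀ V, (∫⋯∫⁻_s, den ∂μ) V ≠ 0) (htop : ∀ V, (∫⋯∫⁻_s, den ∂μ) V ≠ ∞) :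
    normTermKernel μ s den χ hden hχ ∘ₘ Measure.pi μ = (Measure.pi μ).withDensity χ := by
  ext A hA
  rw [Measure.bind_apply hA (Kernel.aemeasurable _), withDensity_apply _ hA, ← lintegral_indicator hA]
  have hN : Measurable (∫⋯∫⁻_s, χ * A.indicator 1 ∂μ) := (hχ.mul (measurable_one.indicator hA)).lmarginal μ
  have hind : B15.BasicStep.IndepOf s (∫⋯∫⁻_s, χ * A.indicator 1 ∂μ) := B15.BasicStep.indepOf_lmarginal μ s _
  have key : ∫⋯∫⁻_s, (fun V => den V * ((∫⋯∫⁻_s, χ * A.indicator 1 ∂μ) V / (∫⋯∫⁻_s, den ∂μ) V)) ∂μ =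
      ∫⋯∫⁻_s, χ * A.indicator 1 ∂μ :=
    B15.BasicStep.lmarginal_norm_term s hind hden h0 htop
  have e1 : (fun V => normTermKernel μ s den χ hden hχ V A) =
      fun V => den V * ((∫⋯∫⁻_s, χ * A.indicator 1 ∂μ) V / (∫⋯∫⁻_s, den ∂μ) V) := by
    funext V
    rw [normTermKernel_apply_set hden hχ hA, ENNReal.div_eq_inv_mul, mul_assoc]
  have h2 : ∫⁻ V, den V * ((∫⋯∫⁻_s, χ * A.indicator 1 ∂μ) V / (∫⋯∫⁻_s, den ∂μ) V) ∂Measure.pi μ =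
      ∫⁻ V, (χ * A.indicator 1 : (∀ i, G i) → ℝ≥0∞) V ∂Measure.pi μ :=
    lintegral_eq_of_lmarginal_eq s (hden.mul (hN.div (hden.lmarginal μ))) (hχ.mul (measurable_one.indicator hA)) key
  rw [e1, h2]
  refine lintegral_congr fun x => ?_
  by_cases hx : x ∈ A <;> simp [hx, Pi.mul_apply]

end

end Summit.QuantumFields.BalabanUV.T4Continuum.Spine.NE7b.StepKernelNormTerm
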